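import Literature.AnabelianGeometry.SemiGraphs.BTempQDPairComponentPairs
import Literature.AnabelianGeometry.SemiGraphs.BTempQDPairRealisation
import HarnessLib

/-!
# Semi-graphs of anabelioids, Appendix, proof of Theorem A.4: `Hom^((B, Γ_B), (C, Γ_C))` for WEAKLY
# CONNECTED QD-pairs of `B^temp(Π)` as matching families over the connected components, and the
# bijections `Hom^((B, Γ_B), (C, Γ_C)) ⥲ Hom^((B′, Γ_B′), (C′, Γ_C′)) ⥲ Hom_T(q(B, Γ_B), q(C, Γ_C))`

Mochizuki, *Semi-graphs of anabelioids*, Publ. RIMS **42** (2006) 221–322, Appendix, proof of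
Theorem A.4, manuscript p. 84 l. 9 – p. 85 l. 2 (PRIMS p. 314 l. 9 – l. −3)
[cite: MochizukiSemiAnbd2006, Thm A.4 proof p.84]: "… any choice of elements `γ_B ∈ Γ_B`, `γ_C ∈ Γ_C`
such that `γ_B(B′) = B″`, `γ_C(C′) = C″` determines a bijection
`Hom^((B′, Γ_B′), (C′, Γ_C′)) ⥲ Hom^((B″, Γ_B″), (C″, Γ_C″))` which is, in fact, independent of the
choice of `γ_B`, `γ_C`. Thus, if we define `Hom^((B, Γ_B), (C, Γ_C)) ⊆ ∏_{B′, C′} Hom^((B′, Γ_B′), (C′, Γ_C′))`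
[where the product ranges over all choices of connected components `B′`, `C′` of `B`, `C`,
respectively] to be the subset of collections of elements that correspond via these bijections, then
the natural projections of this direct product determine bijections as follows:
`Hom^((B, Γ_B), (C, Γ_C)) ⥲ Hom^((B′, Γ_B′), (C′, Γ_C′)) ⥲ Hom_{T_i}(q_i((B′, Γ_B′)), q_i((C′, Γ_C′)))
⥲ Hom_{T_i}(q_i((B, Γ_B)), q_i((C, Γ_C)))`".

Row **A4-lim-wc** of `plan/L3/SUBDAG-SemiAnbd-Cor311.md` (holder abc-iut-w5-d129), PART (wc-3) (seat
abc-iut-w4-d048; wc-1 = `BTempQDPairComponentPairs.lean`, wc-2 = abc-iut-w4-d089's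
`QDPairHomHatTransport.lean`), for the model temperoid `T = B^temp(Π)`; components indexed by their
points (`B′ = Π · b`, `QDPair.componentPair P b`):

* `QDPair.HomHat.anchor hP b c : Hom^((B′, Γ_B′), (C′, Γ_C′)) → Hom_T(q(B, Γ_B), q(C, Γ_C))`, the
  composite of the comparison map `Hom^ → Hom_T` with the identifications `q(B′, Γ_B′) ≅ q(B, Γ_B)`,
  `q(C′, Γ_C′) → q(C, Γ_C)`; **`anchor_map`**: it is UNCHANGED by transport along ANY admissible
  `(γ_B, γ_C)` — the kernel content of "independent of the choice of `γ_B`, `γ_C`";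
  `anchor_injective` (weakly connected `(C, Γ_C)`; from abc-iut-w4-d081's `homHatToHom_injective`),
  `anchor_surjective` (`Π` tempered; from abc-iut-w5-d129's `homHatToHom_surjective`);
* **`QDPair.HomHatWC P C`** := the matching families in `∏_{(b, c)} Hom^((B_b, Γ_b), (C_c, Γ_c))`
  ("the subset of collections of elements that correspond via these bijections");
* **`HomHatWC.proj_bijective`**: for `(B, Γ_B)`, `(C, Γ_C)` weakly connected every projection
  `Hom^((B, Γ_B), (C, Γ_C)) → Hom^((B′, Γ_B′), (C′, Γ_C′))` is a bijection;
* **`HomHatWC.toHom`**, `toHom_eq` (independent of the component used) and **`toHom_bijective`**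
  (`Π` tempered): `Hom^((B, Γ_B), (C, Γ_C)) ⥲ Hom_T(q(B, Γ_B), q(C, Γ_C))`.

Not here (recorded): the extension "to pairs of objects of `D_i` that are not necessarily weakly
connected" (p. 84 l. −3 ff., via countable connectedness) and the category `P_i` (row A4-lim-P).
Elementary `Π`-set theory; nothing refers to the IUT corpus; no side is taken on any disputed claim.
-/

open CategoryTheory

namespace Literature.AnabelianGeometry.SemiGraphs

open Literature.AlgebraicGeometry.Frobenioids.QuasiTemperoid.BTempConnected (hom_ρ ρ_inv_apply)

universe u

namespace QDPair

variable {G : Type u} [Group G] [TopologicalSpace G]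

/-! ### Admissible `γ_B`: weak connectedness supplies one for every pair of components -/

/-- For `(B, Γ_B)` weakly connected and points `b, b′ ∈ B` there is `γ ∈ Γ_B` with `γ(Π · b) = Π · b′`
(i.e. `γ b ∈ Π · b′`). [cite: MochizukiSemiAnbd2006, Thm A.4 proof p.84] -/
theorem exists_aut_mem_orbit {P : QDPair (BTemp G)} (hP : P.IsWeaklyConnected) (b b' : P.A.obj.V) :
    ∃ γ ∈ P.Γ, ∃ a : G, P.A.obj.ρ a b' = γ.hom.hom.hom b := by
  obtain ⟨γ, hγ, y, hy⟩ := P.exists_aut_apply_eq_of_isWeaklyConnected b hP b'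
  obtain ⟨a, ha⟩ := y.2
  refine ⟨γ, hγ, a⁻¹, ?_⟩
  rw [← ha, hom_ρ] at hy
  -- `hy : a · γ b = b′`
  have h2 := congrArg (P.A.obj.ρ a⁻¹) hy
  rw [ρ_inv_apply] at h2
  exact h2.symm

/-! ### The anchor `Hom^((B′, Γ_B′), (C′, Γ_C′)) → Hom_T(q(B, Γ_B), q(C, Γ_C))` -/

section Anchor

variable [IsTopologicalGroup G] {P C : QDPair (BTemp G)}

/-- `q` inverts the isomorphisms of QD-pairs: `q(e)⁻¹ = q(e⁻¹)`. [cite: MochizukiSemiAnbd2006, Thm A.4 proof p.84] -/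
theorem inv_orbitQuotientMap_iso {P₁ P₂ : QDPair (BTemp G)} (e : P₁ ≅ P₂) :
    haveI := isIso_orbitQuotientMap_iso e
    inv (orbitQuotientMap e.hom) = orbitQuotientMap e.inv := by
  haveI := isIso_orbitQuotientMap_iso e
  apply IsIso.inv_eq_of_hom_inv_id
  have h := (orbitQuotientFunctor (G := G)).map_comp e.hom e.inv
  rw [e.hom_inv_id, CategoryTheory.Functor.map_id] at h
  exact h.symm

/-- For `(B, Γ_B)` weakly connected: `q(B, Γ_B) ⥲ q(B′, Γ_B′) → q(B″, Γ_B″)` induced by `γ` with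
`γ(B′) = B″` is `q(B, Γ_B) ⥲ q(B″, Γ_B″)`. [cite: MochizukiSemiAnbd2006, Thm A.4 proof p.84] -/
theorem componentQuotientIso_inv_comp (hP : P.IsWeaklyConnected) {b b' : P.A.obj.V} (γ : Aut P.A)
    (h : ∃ a : G, P.A.obj.ρ a b' = γ.hom.hom.hom b) (hγ : γ ∈ P.Γ) :
    (P.componentQuotientIso b hP).inv ≫ orbitQuotientMap (componentHom γ h hγ) =
      (P.componentQuotientIso b' hP).inv := by
  rw [Iso.inv_comp_eq, Iso.eq_comp_inv]
  exact orbitQuotientMap_componentHom_comp γ h hγ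

/-- **The anchor**: `Hom^((B′, Γ_B′), (C′, Γ_C′)) → Hom_T(q(B, Γ_B), q(C, Γ_C))`,
`x ↦ (q(B′, Γ_B′) ⥲ q(B, Γ_B))⁻¹ ≫ (Hom^ → Hom_T)(x) ≫ (q(C′, Γ_C′) → q(C, Γ_C))` — the composite of the
last two printed bijections. [cite: MochizukiSemiAnbd2006, Thm A.4 proof p.84] -/
noncomputable def HomHat.anchor (hP : P.IsWeaklyConnected) (b : P.A.obj.V) (c : C.A.obj.V)
    (x : HomHat (P.componentPair b) (C.componentPair c)) : P.orbitQuotient ⟶ C.orbitQuotient :=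
  (P.componentQuotientIso b hP).inv ≫ homHatToHom _ _ x ≫ orbitQuotientMap (C.componentIncl c)

/-- **The anchor is unchanged by transport along any admissible `(γ_B, γ_C)`** ("independent of
the choice of `γ_B`, `γ_C`"; and the transported element corresponds to the same arrow of `T`).
[cite: MochizukiSemiAnbd2006, Thm A.4 proof p.84] -/
theorem HomHat.anchor_map (hP : P.IsWeaklyConnected) {b b' : P.A.obj.V} {c c' : C.A.obj.V} (γ : Aut P.A)
    (hb : ∃ a : G, P.A.obj.ρ a b' = γ.hom.hom.hom b) (hγ : γ ∈ P.Γ) (δ : Aut C.A)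
    (hc : ∃ a : G, C.A.obj.ρ a c' = δ.hom.hom.hom c) (hδ : δ ∈ C.Γ)
    (x : HomHat (P.componentPair b) (C.componentPair c)) :
    HomHat.anchor hP b' c' (HomHat.map (componentIso γ hb hγ) (componentIso δ hc hδ).hom x) =
      HomHat.anchor hP b c x := by
  unfold HomHat.anchor
  rw [homHatToHom_map, inv_orbitQuotientMap_iso]
  change (P.componentQuotientIso b' hP).inv ≫
      (orbitQuotientMap (componentHom γ⁻¹ (exists_ρ_eq_inv_apply γ hb) (P.Γ.inv_mem hγ)) ≫
        homHatToHom _ _ x ≫ orbitQuotientMap (componentHom δ hc hδ)) ≫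
      orbitQuotientMap (C.componentIncl c') = _
  simp only [Category.assoc]
  rw [orbitQuotientMap_componentHom_comp δ hc hδ, ← Category.assoc,
    componentQuotientIso_inv_comp hP γ⁻¹ (exists_ρ_eq_inv_apply γ hb) (P.Γ.inv_mem hγ)]

/-- The anchor is injective when `(C, Γ_C)` is weakly connected too (`Hom^ → Hom_T` is injective, the
two outer maps are isomorphisms). [cite: MochizukiSemiAnbd2006, Thm A.4 proof p.84] -/
theorem HomHat.anchor_injective (hP : P.IsWeaklyConnected) (hC : C.IsWeaklyConnected) (b : P.A.obj.V)
    (c : C.A.obj.V) :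
    Function.Injective (HomHat.anchor hP b c (C := C)) := by
  intro x y hxy
  haveI := C.isIso_orbitQuotientMap_componentIncl c hC
  unfold HomHat.anchor at hxy
  rw [cancel_epi, cancel_mono] at hxy
  exact homHatToHom_injective _ _ hxy

/-- The anchor is surjective when `Π` is tempered (`Hom^ → Hom_T` is surjective for the strongly
connected `(B′, Γ_B′)`, abc-iut-w5-d129's realisation). [cite: MochizukiSemiAnbd2006, Thm A.4 proof p.84] -/
theorem HomHat.anchor_surjective (hP : P.IsWeaklyConnected) (hG : IsTempered G) (hC : C.IsWeaklyConnected)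
    (b : P.A.obj.V) (c : C.A.obj.V) : Function.Surjective (HomHat.anchor hP b c (C := C)) := by
  intro u
  haveI := C.isIso_orbitQuotientMap_componentIncl c hC
  obtain ⟨x, hx⟩ := homHatToHom_surjective hG (C.componentPair c)
    (P.componentPair_isStronglyConnected b)
    ((P.componentQuotientIso b hP).hom ≫ u ≫ inv (orbitQuotientMap (C.componentIncl c)))
  refine ⟨x, ?_⟩
  unfold HomHat.anchor
  rw [hx]
  simp only [Category.assoc, IsIso.inv_hom_id, Category.comp_id, Iso.inv_hom_id_assoc]

/-- **The anchor is a bijection** (`Π` tempered, both pairs weakly connected).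
[cite: MochizukiSemiAnbd2006, Thm A.4 proof p.84] -/
theorem HomHat.anchor_bijective (hP : P.IsWeaklyConnected) (hG : IsTempered G) (hC : C.IsWeaklyConnected)
    (b : P.A.obj.V) (c : C.A.obj.V) : Function.Bijective (HomHat.anchor hP b c (C := C)) :=
  ⟨HomHat.anchor_injective hP hC b c, HomHat.anchor_surjective hP hG hC b c⟩

end Anchor

/-! ### `Hom^((B, Γ_B), (C, Γ_C))` as matching families -/

section WC

variable (P C : QDPair (BTemp G))

/-- A family `(x_{B′, C′}) ∈ ∏_{B′, C′} Hom^((B′, Γ_B′), (C′, Γ_C′))` (components indexed by points)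
**matches** if its members "correspond via these bijections": transport along every admissible
`(γ_B, γ_C)` carries `x_{B′, C′}` to `x_{B″, C″}`. [cite: MochizukiSemiAnbd2006, Thm A.4 proof p.84] -/
def HomHat.IsMatching
    (x : ∀ (b : P.A.obj.V) (c : C.A.obj.V), HomHat (P.componentPair b) (C.componentPair c)) : Prop :=
  ∀ ⦃b b' : P.A.obj.V⦄ ⦃c c' : C.A.obj.V⦄ (γ : Aut P.A)
    (hb : ∃ a : G, P.A.obj.ρ a b' = γ.hom.hom.hom b) (hγ : γ ∈ P.Γ) (δ : Aut C.A)
    (hc : ∃ a : G, C.A.obj.ρ a c' = δ.hom.hom.hom c) (hδ : δ ∈ C.Γ),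
    HomHat.map (componentIso γ hb hγ) (componentIso δ hc hδ).hom (x b c) = x b' c'

/-- **`Hom^((B, Γ_B), (C, Γ_C))` for (weakly connected) QD-pairs of `B^temp(Π)`**: "the subset of
collections of elements [of `∏_{B′, C′} Hom^((B′, Γ_B′), (C′, Γ_C′))`] that correspond via these
bijections". [cite: MochizukiSemiAnbd2006, Thm A.4 proof p.84] -/
def HomHatWC : Type (u + 1) :=
  { x : ∀ (b : P.A.obj.V) (c : C.A.obj.V), HomHat (P.componentPair b) (C.componentPair c) //
    HomHat.IsMatching P C x }

variable {P C}

namespace HomHatWC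

/-- The natural projection `Hom^((B, Γ_B), (C, Γ_C)) → Hom^((B′, Γ_B′), (C′, Γ_C′))`.
[cite: MochizukiSemiAnbd2006, Thm A.4 proof p.84] -/
def proj (b : P.A.obj.V) (c : C.A.obj.V) (x : HomHatWC P C) :
    HomHat (P.componentPair b) (C.componentPair c) :=
  x.1 b c

/-- Two matching families agreeing at one pair of components agree everywhere.
[cite: MochizukiSemiAnbd2006, Thm A.4 proof p.84] -/
theorem ext_of_proj_eq (hP : P.IsWeaklyConnected) (hC : C.IsWeaklyConnected) {b : P.A.obj.V}
    {c : C.A.obj.V} {x y : HomHatWC P C} (h : proj b c x = proj b c y) : x = y := by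
  apply Subtype.ext
  funext b' c'
  obtain ⟨γ, hγ, hb⟩ := exists_aut_mem_orbit hP b b'
  obtain ⟨δ, hδ, hc⟩ := exists_aut_mem_orbit hC c c'
  rw [← x.2 γ hb hγ δ hc hδ, ← y.2 γ hb hγ δ hc hδ]
  exact congrArg _ h

/-- **The projections are injective** (both pairs weakly connected). [cite: MochizukiSemiAnbd2006, Thm A.4 proof p.84] -/
theorem proj_injective (hP : P.IsWeaklyConnected) (hC : C.IsWeaklyConnected) (b : P.A.obj.V)
    (c : C.A.obj.V) : Function.Injective (proj b c : HomHatWC P C → _) :=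
  fun _ _ h => ext_of_proj_eq hP hC h

variable [IsTopologicalGroup G]

/-- **Extension of an element of `Hom^((B′, Γ_B′), (C′, Γ_C′))` to a matching family**, by transporting
it along SOME admissible `(γ_B, γ_C)` to every other pair of components — the family matches because
all its members have the same anchor (`anchor_map`) and the anchor is injective.
[cite: MochizukiSemiAnbd2006, Thm A.4 proof p.84] -/
theorem exists_proj_eq (hP : P.IsWeaklyConnected) (hC : C.IsWeaklyConnected) (b : P.A.obj.V)
    (c : C.A.obj.V) (z : HomHat (P.componentPair b) (C.componentPair c)) :
    ∃ x : HomHatWC P C, proj b c x = z := by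
  classical
  -- chosen `γ_{b′}` and `δ_{c′}`
  have eB := fun b' => exists_aut_mem_orbit hP b b'
  have eC := fun c' => exists_aut_mem_orbit hC c c'
  let x : ∀ (b' : P.A.obj.V) (c' : C.A.obj.V), HomHat (P.componentPair b') (C.componentPair c') :=
    fun b' c' => HomHat.map
      (componentIso (eB b').choose (eB b').choose_spec.2 (eB b').choose_spec.1)
      (componentIso (eC c').choose (eC c').choose_spec.2 (eC c').choose_spec.1).hom z
  have hx : ∀ b' c', HomHat.anchor hP b' c' (x b' c') = HomHat.anchor hP b c z := fun b' c' =>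
    HomHat.anchor_map hP _ _ _ _ _ _ z
  refine ⟨⟨x, ?_⟩, ?_⟩
  · intro b₁ b₂ c₁ c₂ γ hb hγ δ hc hδ
    apply HomHat.anchor_injective hP hC b₂ c₂
    rw [HomHat.anchor_map, hx, hx]
  · apply HomHat.anchor_injective hP hC b c
    exact hx b c

/-- **"the natural projections of this direct product determine bijections
`Hom^((B, Γ_B), (C, Γ_C)) ⥲ Hom^((B′, Γ_B′), (C′, Γ_C′))`"** (both pairs weakly connected).
[cite: MochizukiSemiAnbd2006, Thm A.4 proof p.84] -/
theorem proj_bijective (hP : P.IsWeaklyConnected) (hC : C.IsWeaklyConnected) (b : P.A.obj.V)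
    (c : C.A.obj.V) : Function.Bijective (proj b c : HomHatWC P C → _) :=
  ⟨proj_injective hP hC b c, exists_proj_eq hP hC b c⟩

/-- **The arrow `q(B, Γ_B) → q(C, Γ_C)` of a matching family**, computed through the component pair
`(B′, Γ_B′), (C′, Γ_C′)` of the points `b, c`. [cite: MochizukiSemiAnbd2006, Thm A.4 proof p.84] -/
noncomputable def toHom (hP : P.IsWeaklyConnected) (b : P.A.obj.V) (c : C.A.obj.V) (x : HomHatWC P C) :
    P.orbitQuotient ⟶ C.orbitQuotient :=
  HomHat.anchor hP b c (proj b c x)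

/-- `toHom` does not depend on the components used to compute it.
[cite: MochizukiSemiAnbd2006, Thm A.4 proof p.84] -/
theorem toHom_eq (hP : P.IsWeaklyConnected) (hC : C.IsWeaklyConnected) (x : HomHatWC P C)
    (b b' : P.A.obj.V) (c c' : C.A.obj.V) : toHom hP b c x = toHom hP b' c' x := by
  obtain ⟨γ, hγ, hb⟩ := exists_aut_mem_orbit hP b b'
  obtain ⟨δ, hδ, hc⟩ := exists_aut_mem_orbit hC c c'
  unfold toHom proj
  rw [← x.2 γ hb hγ δ hc hδ, HomHat.anchor_map]

/-- **`Hom^((B, Γ_B), (C, Γ_C)) ⥲ Hom_{T}(q(B, Γ_B), q(C, Γ_C))`** for weakly connected QD-pairs of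
`B^temp(Π)`, `Π` tempered: the composite of the three printed bijections.
[cite: MochizukiSemiAnbd2006, Thm A.4 proof p.84] -/
theorem toHom_bijective (hG : IsTempered G) (hP : P.IsWeaklyConnected) (hC : C.IsWeaklyConnected)
    (b : P.A.obj.V) (c : C.A.obj.V) : Function.Bijective (toHom hP b c : HomHatWC P C → _) :=
  (HomHat.anchor_bijective hP hG hC b c).comp (proj_bijective hP hC b c)

end HomHatWC

end WC

end QDPair

end Literature.AnabelianGeometry.SemiGraphs
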